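import Literature.MathematicalPhysics.QuantumFieldTheory.Balaban1983to89.B8BlockConstantLiftStabilityRec
import Literature.MathematicalPhysics.QuantumFieldTheory.Balaban1983to89.B7Prop9FlatRec
import Literature.MathematicalPhysics.QuantumFieldTheory.Balaban1983to89.B7Eq170Flat

/-!
# `Balaban1983to89.B8ExpMeanLogOscFromPointwiseRec` — [Balaban1985Averaging] (78)–(80), (167): THE IN-BLOCK OSCILLATION ROWS OF THE RECORD AVERAGES `R̄₀ⁱτ` OF A
# UNITARY GAUGE FUNCTION UNDER A CELL, FROM ITS POINTWISE MULTISCALE OSCILLATION with geometric decay — the `p_i` letters of road (B′)'s cross-term bound for a factor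
# that is only known POINTWISE (the junction's `τ` = the transformation between two axial gauges of one orbit), flat background, odd `L`

statement-level skeleton of published theorems with citation tags; proofs where landed; nothing here is a claim about the Yang–Mills mass gap

CITATION HEADER (lean-in-tree rule).  Cell `pub-ymgap` (HUMAN RULING D-0062), the N05-REC → K0-road JUNCTION (width seat `pub-ymgap-dag-n07-w3` g13).  [3] = [Balaban1985Averaging] (78)–(80)
p. 30, (166)–(167) p. 44, (26)–(27) pp. 21–22, (22)–(23) p. 21; [I] = [Balaban1987RG1] (0.3)–(0.4) pp. 252–253.  `--kind proof --supports stmt-QuantumFields-20541` (K0⁷; count-neutral;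
no definition).  REUSED BY NAME: dag-n05-e's `B7SectCDGaugeAveragesRec.{uavgZ, savgZ, SexpZ}` ∕ `B7Prop9FlatRec.SexpZ_eq_bmean` ∕ `B7Eq170Flat.norm_bmean_le` ∕ `B7Prop6Bound.mul_sub_one_norm_le` ∕
`B7Prop2Explicit.{unitaryUnits, star_mlog_eq_neg, unitaryUnits_le_U1}` ∕ `B8BlockConstantLiftStabilityRec.{underZ_add, underZ_pow_smul}`, dag-n05-d's `B8Eq119TwistedAxialRec.{UnderZ,
underZ_one_block, underZ_one_centre}`, `MatrixLog.norm_mlog_le_two_mul`, Mathlib's `Real.abs_exp_sub_one_sub_id_le`; SERVES this seat's ✓p747787 `B8ExpMeanLogCrossTermGeomRec.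
rbar_one_mul_sub_mul_le_tower_local` (its `hp` rows).

WHY.  In road (B′) the first factor of the junction's product `a·u₀` is (up to block constants, ✓p752835) the transformation `τ` between two axial gauges of the same small-field orbit;
what the two axialities give is POINTWISE: `τ` varies by `≤ ω·θ^{j−1−i}` over every level-`(i+1)` block under the cell (`θ = 1∕L`).  The cross-term bound ✓p747787 wants instead the
(167)-shaped rows «`‖(R̄₀ⁱτ(L·z))⁻¹·R̄₀ⁱτ(L·z + r) − 1‖ ≤ p_i`» for the RECORD AVERAGES (79)–(80) of `τ`, with `p_i` geometric.  THIS FILE: the record average `R̄₀ⁱτ(x)` stays within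
`8ω·θ^{j−i}` of the value of `τ` at the fine centre `Lⁱ·x` of its block (induction on `i`: one step is `R̄₀ⁱτ(L·z)·exp[Σ_r L⁻ᵈ log W_r]` with `‖W_r − 1‖ ≤ ω_i + 2·8ωθ^{j−i} + …`, the
re-centring loss per level (a factor `< 8`) being beaten by the decay `θ ≤ 1∕8` of the input), hence the rows with `p_i := 4ω·θ^{j−1−i}`; unitarity of the averages under the cell is
carried along ([3] (22)–(23): skew-adjoint logarithms), so the `U1` rows come with it.

WHAT IS PROVED (sorry-free; C⋆-algebra carrier, unitary `τ` under the cell, `0 ≤ θ ≤ 1∕8`, `0 ≤ ω ≤ 1∕128`).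
§1 private arithmetic and `ℤᵈ` bookkeeping (`pow_smul_Lsmul_eq_pow_succ_smul`, `underZ_centre_of_block`).
§2 ★★★ `uavgZ_one_unitary_and_near_centre_under` — for `i ≤ j` and `x` under `y` at depth `j − i`: `R̄₀ⁱτ(x)` is unitary and `‖τ(Lⁱ·x)⁻¹·R̄₀ⁱτ(x) − 1‖ ≤ 8ω·θ^{j−i}`.
§3 ★★★ `osc_rows_of_pointwise_under` — the `hp` rows of `rbar_one_mul_sub_mul_le_tower_local` for `τ` with `p_i := 4ω·θ^{j−(i+1)}`; ★ `norm_uavgZ_one_le_one_of_pointwise_under` — the `U1`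
   rows (`‖R̄₀ⁱτ(L·z)‖ ≤ 1`, `‖R̄₀ⁱτ(L·z)⁻¹‖ ≤ 1`) at the centres under the cell.
HONEST FRAMING: count-neutral helper; an elementary stability estimate for iterated exp-mean-log averages ([3] (78)–(80)) — nothing of [3]∕[I] asserted or discharged; the pointwise
oscillation INPUT for the junction's `τ` (from the two axialities, sym vs radial) is NOT produced here; `HThm4RecSym152PhiE(G)` ∕ `HThm4Rec*` UNDISCHARGED (CONDITIONAL premises);
N07 ∕ N05 NOT discharged; K0⁷ ∕ K1⁹ NOT closed; counts unmoved (typed 28∕28 · discharged 8∕28); one finite 𝕋⁴ programme at fixed ε — R4 closes the conditional finite-𝕋⁴ rung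
`BalabanLadder.UV` only; the YM mass gap (Clay) is NOT proved by any of this; nothing continuum ∕ ℝ⁴ ∕ OS.  No `def`, no `sorry`, no `instance`, no `notation`.
-/

set_option autoImplicit false

noncomputable section

open scoped BigOperators

namespace Literature.MathematicalPhysics.QuantumFieldTheory.Balaban1983to89.B8ExpMeanLogOscFromPointwiseRec

open B7Prop1Explicit hiding Site
open B7Prop1Explicit renaming Site → SiteZ
open B7SectEFLinearisationRec (blockSitesZ mem_blockSitesZ)
open B7SectCDGaugeAveragesRec (uavgZ uavgZ_zero uavgZ_succ savgZ SexpZ)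
open B8Eq119TwistedAxialRec (UnderZ underZ_zero_iff underZ_one_block underZ_one_centre)
open B8BlockConstantLiftStabilityRec (underZ_add underZ_pow_smul)
open B7Prop2Explicit (unitaryUnits mem_unitaryUnits star_mlog_eq_neg unitaryUnits_le_U1)
open B7Prop6Bound (mul_sub_one_norm_le)
open B7Eq170Flat (bmean norm_bmean_le)
open BlockAveragingZd (offZ)
open MatrixLog (mlog norm_mlog_le_two_mul)

variable {d : ℕ}

/-! ## §1  Arithmetic and `ℤᵈ` bookkeeping -/

/-- The one-step arithmetic of §2: with `u = ω·θ^{j−(i+1)} ≤ 1∕128`, `θ ≤ 1∕8`, the row bound `P = u + 16θu + 8θu²` is `≤ 4u`, `≤ 1∕4`, and the re-centred deviation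
`(1 + 8θu)(1 + 2P + (2P)²) − 1` is `≤ 8u`. [folklore] -/
private theorem step_arith {θ u : ℝ} (hθ0 : 0 ≤ θ) (hθ : θ ≤ 1 / 8) (hu0 : 0 ≤ u) (hu : u ≤ 1 / 128) :
    u + 16 * θ * u + 8 * θ * u ^ 2 ≤ 4 * u ∧ u + 16 * θ * u + 8 * θ * u ^ 2 ≤ 1 / 4 ∧ 2 * (u + 16 * θ * u + 8 * θ * u ^ 2) ≤ 1 ∧
      (1 + 8 * θ * u) * (1 + 2 * (u + 16 * θ * u + 8 * θ * u ^ 2) + (2 * (u + 16 * θ * u + 8 * θ * u ^ 2)) ^ 2) - 1 ≤ 8 * u := by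
  have hθu : θ * u ≤ 1 / 8 * u := mul_le_mul_of_nonneg_right hθ hu0
  have hu2 : u ^ 2 ≤ 1 / 128 * u := by nlinarith
  have hθu2 : θ * u ^ 2 ≤ 1 / 8 * (1 / 128 * u) := by nlinarith
  have hP : u + 16 * θ * u + 8 * θ * u ^ 2 ≤ 4 * u := by nlinarith
  have hP0 : 0 ≤ u + 16 * θ * u + 8 * θ * u ^ 2 := by positivity
  refine ⟨hP, by nlinarith, by nlinarith, ?_⟩
  -- `P ≤ (25/8)·u`, then everything is linear in `u` up to products bounded by `u ≤ 1/128`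
  have hP' : u + 16 * θ * u + 8 * θ * u ^ 2 ≤ 25 / 8 * u := by nlinarith
  set P := u + 16 * θ * u + 8 * θ * u ^ 2 with hPdef
  have hP2 : P ^ 2 ≤ 25 / 8 * u * P := by nlinarith
  have hP2' : P ^ 2 ≤ (25 / 8) * (1 / 128) * (25 / 8 * u) := by nlinarith
  have hX : 2 * P + (2 * P) ^ 2 ≤ 7 * u := by nlinarith
  have hX0 : 0 ≤ 2 * P + (2 * P) ^ 2 := by positivity
  have hθuX : 8 * θ * u * (2 * P + (2 * P) ^ 2) ≤ u * (7 * (1 / 128)) := by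
    have h1 : 8 * θ * u ≤ u := by nlinarith
    have h2 : 2 * P + (2 * P) ^ 2 ≤ 7 * (1 / 128) := by nlinarith
    calc 8 * θ * u * (2 * P + (2 * P) ^ 2) ≤ u * (2 * P + (2 * P) ^ 2) := mul_le_mul_of_nonneg_right h1 hX0
      _ ≤ u * (7 * (1 / 128)) := mul_le_mul_of_nonneg_left h2 hu0
  nlinarith

/-- `‖e^S − 1‖ ≤ a + a²` when `‖S‖ ≤ a ≤ 1` ([3] (27): `|e^S − 1| ≤ e^{|S|} − 1`, and `e^a − 1 − a ≤ a²` for `|a| ≤ 1`). [cite: Balaban1985Averaging, (27) p.22] -/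
private theorem norm_exp_sub_one_le_lin {𝔸 : Type*} [NormedRing 𝔸] [NormedAlgebra ℂ 𝔸] [CompleteSpace 𝔸] {S : 𝔸} {a : ℝ} (hS : ‖S‖ ≤ a) (ha1 : a ≤ 1) :
    ‖NormedSpace.exp S - 1‖ ≤ a + a ^ 2 := by
  have ha0 : 0 ≤ a := (norm_nonneg _).trans hS
  have h1 := (norm_exp_sub_one_le_of_norm_le hS).1
  have h2 : |Real.exp a - 1 - a| ≤ a ^ 2 := Real.abs_exp_sub_one_sub_id_le (by rw [abs_of_nonneg ha0]; exact ha1)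
  have h3 : Real.exp a - 1 ≤ a + a ^ 2 := by have := (abs_le.1 h2).2; linarith
  exact h1.trans h3

/-- `Lⁱ·(L·z) = L^{i+1}·z`. [folklore] -/
private theorem pow_smul_Lsmul_eq_pow_succ_smul (L i : ℕ) (z : SiteZ d) : ((L : ℤ) ^ i) • ((L : ℤ) • z) = ((L : ℤ) ^ (i + 1)) • z := by
  rw [smul_smul, ← pow_succ]

/-- The fine centre `Lⁱ·x` of a block point `x = L·z + r` of `z` lies under `z` at depth `i + 1`. [cite: Balaban1987RG1, (0.3) p.252 (bookkeeping)] -/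
private theorem underZ_centre_of_block {L : ℕ} (hL : Odd L) (i : ℕ) (z : SiteZ d) (r : Fin d → Fin L) :
    UnderZ L (i + 1) z (((L : ℤ) ^ i) • ((L : ℤ) • z + offZ L r)) := by
  obtain ⟨s, hs⟩ := hL
  have h := underZ_add ⟨s, hs⟩ (underZ_one_block (by omega : L = 2 * s + 1) z r) (underZ_pow_smul L i ((L : ℤ) • z + offZ L r))
  rwa [add_comm] at h

/-! ## §2  The record averages of `τ` stay unitary and near the centre value of `τ` -/

section Main

variable {𝔹 : Type*} [CStarAlgebra 𝔹] [Nontrivial 𝔹]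

/-- The one-step ROW estimate: from unitarity and closeness-to-centre at level `i` (deviation `a`) at the centre `L·z` and at a block point `L·z + r`, and the pointwise bound
`‖τ(c)⁻¹τ(c_r) − 1‖ ≤ u` between the two fine centres, the (78) family member `W_r = R̄₀ⁱτ(L·z)⁻¹·R̄₀ⁱτ(L·z + r)` satisfies `‖W_r − 1‖ ≤ (1 + u)(1 + a) − 1 + a`.
[cite: Balaban1985Averaging, (78) p.30, (167) p.44 (bookkeeping)] -/
private theorem row_core {T C Cr R0 Rr : 𝔹ˣ} (hT : T ∈ unitaryUnits 𝔹) (hR0 : R0 ∈ unitaryUnits 𝔹) {a u : ℝ}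
    (h0 : ‖((T⁻¹ * R0 : 𝔹ˣ) : 𝔹) - 1‖ ≤ a) (hr : ‖((Cr⁻¹ * Rr : 𝔹ˣ) : 𝔹) - 1‖ ≤ a) (hpt : ‖((T⁻¹ * Cr : 𝔹ˣ) : 𝔹) - 1‖ ≤ u) (hC : C = T) :
    ‖((R0⁻¹ * Rr : 𝔹ˣ) : 𝔹) - 1‖ ≤ (1 + u) * (1 + a) - 1 + a := by
  subst hC
  -- `R0⁻¹ Rr = A₀⁻¹ B` with `A₀ = C⁻¹R0`, `B = (C⁻¹Cr)(Cr⁻¹Rr)`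
  have hA : C⁻¹ * R0 ∈ unitaryUnits 𝔹 := (unitaryUnits 𝔹).mul_mem ((unitaryUnits 𝔹).inv_mem hT) hR0
  have hAinv : ‖(((C⁻¹ * R0)⁻¹ : 𝔹ˣ) : 𝔹)‖ ≤ 1 := (unitaryUnits_le_U1 hA).2
  have hunits : R0⁻¹ * Rr = (C⁻¹ * R0)⁻¹ * ((C⁻¹ * Cr) * (Cr⁻¹ * Rr)) := by group
  have hid : ((R0⁻¹ * Rr : 𝔹ˣ) : 𝔹) - 1 = (((C⁻¹ * R0)⁻¹ : 𝔹ˣ) : 𝔹) * ((((C⁻¹ * Cr) * (Cr⁻¹ * Rr) : 𝔹ˣ) : 𝔹) - ((C⁻¹ * R0 : 𝔹ˣ) : 𝔹)) := by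
    rw [hunits, Units.val_mul, mul_sub, ← Units.val_mul (C⁻¹ * R0)⁻¹ (C⁻¹ * R0), inv_mul_cancel, Units.val_one]
  have hB : ‖(((C⁻¹ * Cr) * (Cr⁻¹ * Rr) : 𝔹ˣ) : 𝔹) - 1‖ ≤ (1 + u) * (1 + a) - 1 := by
    rw [Units.val_mul]
    refine (mul_sub_one_norm_le _ _).trans ?_
    have hu0 : 0 ≤ u := (norm_nonneg _).trans hpt
    have ha0 : 0 ≤ a := (norm_nonneg _).trans hr
    gcongr
  rw [hid]
  calc ‖(((C⁻¹ * R0)⁻¹ : 𝔹ˣ) : 𝔹) * ((((C⁻¹ * Cr) * (Cr⁻¹ * Rr) : 𝔹ˣ) : 𝔹) - ((C⁻¹ * R0 : 𝔹ˣ) : 𝔹))‖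
      ≤ ‖(((C⁻¹ * R0)⁻¹ : 𝔹ˣ) : 𝔹)‖ * ‖(((C⁻¹ * Cr) * (Cr⁻¹ * Rr) : 𝔹ˣ) : 𝔹) - ((C⁻¹ * R0 : 𝔹ˣ) : 𝔹)‖ := norm_mul_le _ _
    _ ≤ 1 * (‖(((C⁻¹ * Cr) * (Cr⁻¹ * Rr) : 𝔹ˣ) : 𝔹) - 1‖ + ‖((C⁻¹ * R0 : 𝔹ˣ) : 𝔹) - 1‖) := by
        gcongr
        calc ‖(((C⁻¹ * Cr) * (Cr⁻¹ * Rr) : 𝔹ˣ) : 𝔹) - ((C⁻¹ * R0 : 𝔹ˣ) : 𝔹)‖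
            = ‖((((C⁻¹ * Cr) * (Cr⁻¹ * Rr) : 𝔹ˣ) : 𝔹) - 1) - (((C⁻¹ * R0 : 𝔹ˣ) : 𝔹) - 1)‖ := by rw [sub_sub_sub_cancel_right]
          _ ≤ _ := norm_sub_le _ _
    _ ≤ 1 * ((1 + u) * (1 + a) - 1 + a) := by gcongr
    _ = (1 + u) * (1 + a) - 1 + a := one_mul _

/-- ★★★ **THE RECORD AVERAGES OF A UNITARY GAUGE FUNCTION STAY UNITARY AND NEAR ITS CENTRE VALUES UNDER A CELL, FROM POINTWISE MULTISCALE OSCILLATION** ([3] (78)–(80) at the flat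
background, odd `L`): fix a cell `y` of level `j`, `0 ≤ θ ≤ 1∕8`, `0 ≤ ω ≤ 1∕128`.  If `τ` is unitary at every fine site under `y` and, for every `i < j` and every level-`(i+1)` point `z`
under `y`, `‖τ(L^{i+1}·z)⁻¹·τ(w) − 1‖ ≤ ω·θ^{j−(i+1)}` for all fine `w` under `z`, then for every `i ≤ j` and every level-`i` point `x` under `y`: `R̄₀ⁱτ(x)` is unitary and
`‖τ(Lⁱ·x)⁻¹·R̄₀ⁱτ(x) − 1‖ ≤ 8ω·θ^{j−i}`. [cite: Balaban1985Averaging, (78)–(80) p.30, (166)–(167) p.44, (22)–(23) p.21, (26)–(27) pp.21–22; Balaban1987RG1, (0.3)–(0.4) pp.252–253] -/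
theorem uavgZ_one_unitary_and_near_centre_under {L : ℕ} (hL : Odd L) (τ : SiteZ d → 𝔹ˣ) (j : ℕ) (y : SiteZ d) {ω θ : ℝ}
    (hθ0 : 0 ≤ θ) (hθ : θ ≤ 1 / 8) (hω0 : 0 ≤ ω) (hω : ω ≤ 1 / 128)
    (hτ : ∀ x, UnderZ L j y x → τ x ∈ unitaryUnits 𝔹)
    (hpt : ∀ i, i < j → ∀ z, UnderZ L (j - (i + 1)) y z → ∀ w, UnderZ L (i + 1) z w →
      ‖((((τ (((L : ℤ) ^ (i + 1)) • z))⁻¹ * τ w : 𝔹ˣ)) : 𝔹) - 1‖ ≤ ω * θ ^ (j - (i + 1))) :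
    ∀ i, i ≤ j → ∀ x, UnderZ L (j - i) y x →
      uavgZ L (1 : SiteZ d → Fin d → 𝔹ˣ) τ i x ∈ unitaryUnits 𝔹 ∧
        ‖((((τ (((L : ℤ) ^ i) • x))⁻¹ * uavgZ L (1 : SiteZ d → Fin d → 𝔹ˣ) τ i x : 𝔹ˣ)) : 𝔹) - 1‖ ≤ 8 * ω * θ ^ (j - i) := by
  have hL1 : 1 ≤ L := by obtain ⟨s, hs⟩ := hL; omega
  intro i
  induction i with
  | zero =>
    intro _ x hx
    rw [Nat.sub_zero] at hx ⊢
    refine ⟨by rw [uavgZ_zero]; exact hτ x hx, ?_⟩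
    rw [uavgZ_zero, pow_zero, one_smul, inv_mul_cancel, Units.val_one, sub_self, norm_zero]
    positivity
  | succ i ih =>
    intro hi z hz
    have hij : i < j := by omega
    have hdepth : j - (i + 1) + 1 = j - i := by omega
    have hθpow : θ ^ (j - i) = θ * θ ^ (j - (i + 1)) := by rw [← hdepth, pow_succ, mul_comm]
    set u : ℝ := ω * θ ^ (j - (i + 1)) with hudef
    have hu0 : 0 ≤ u := by positivity
    have hu1 : u ≤ 1 / 128 := by
      calc u ≤ ω * 1 := by rw [hudef]; exact mul_le_mul_of_nonneg_left (pow_le_one₀ hθ0 (by linarith)) hω0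
        _ ≤ 1 / 128 := by linarith
    obtain ⟨hP4, hP14, hP1, hD⟩ := step_arith hθ0 hθ hu0 hu1
    set P : ℝ := u + 16 * θ * u + 8 * θ * u ^ 2 with hPdef
    -- the centre `L·z` and the block points are under `y` at depth `j − i`
    have hz0 : UnderZ L (j - i) y ((L : ℤ) • z) := by
      have h := underZ_add hL hz (underZ_one_centre L z); rwa [hdepth] at h
    have hzr : ∀ r : Fin d → Fin L, UnderZ L (j - i) y ((L : ℤ) • z + offZ L r) := by
      intro r
      obtain ⟨s, hs⟩ := hL
      have h := underZ_add ⟨s, hs⟩ hz (underZ_one_block (by omega : L = 2 * s + 1) z r); rwa [hdepth] at h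
    -- the fine centre `c = L^{i+1}·z` is under `y` (depth `j`), so `τ(c)` is unitary
    have hc : UnderZ L j y (((L : ℤ) ^ (i + 1)) • z) := by
      have h := underZ_add hL hz (underZ_pow_smul L (i + 1) z); rwa [Nat.sub_add_cancel hi] at h
    have hTc : τ (((L : ℤ) ^ (i + 1)) • z) ∈ unitaryUnits 𝔹 := hτ _ hc
    -- level-`i` data
    obtain ⟨hU0, hA0⟩ := ih hij.le _ hz0
    rw [pow_smul_Lsmul_eq_pow_succ_smul, hθpow] at hA0
    have hA0' : ‖((((τ (((L : ℤ) ^ (i + 1)) • z))⁻¹ * uavgZ L (1 : SiteZ d → Fin d → 𝔹ˣ) τ i ((L : ℤ) • z) : 𝔹ˣ)) : 𝔹) - 1‖ ≤ 8 * θ * u := by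
      rw [hudef]; linarith
    -- the row bound for every block point
    have hrow : ∀ r : Fin d → Fin L,
        ‖((((uavgZ L (1 : SiteZ d → Fin d → 𝔹ˣ) τ i ((L : ℤ) • z))⁻¹ * uavgZ L (1 : SiteZ d → Fin d → 𝔹ˣ) τ i ((L : ℤ) • z + offZ L r) : 𝔹ˣ)) : 𝔹) - 1‖ ≤ P := by
      intro r
      obtain ⟨hUr, hAr⟩ := ih hij.le _ (hzr r)
      rw [hθpow] at hAr
      have hAr' : ‖((((τ (((L : ℤ) ^ i) • ((L : ℤ) • z + offZ L r)))⁻¹ * uavgZ L (1 : SiteZ d → Fin d → 𝔹ˣ) τ i ((L : ℤ) • z + offZ L r) : 𝔹ˣ)) : 𝔹) - 1‖ ≤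
          8 * θ * u := by rw [hudef]; linarith
      have hptr := hpt i hij z hz _ (underZ_centre_of_block hL i z r)
      have h := row_core (Cr := τ (((L : ℤ) ^ i) • ((L : ℤ) • z + offZ L r))) hTc hU0 hA0' hAr' hptr rfl
      refine h.trans (le_of_eq ?_)
      rw [hPdef]; ring
    have hrowU : ∀ r : Fin d → Fin L,
        (uavgZ L (1 : SiteZ d → Fin d → 𝔹ˣ) τ i ((L : ℤ) • z))⁻¹ * uavgZ L (1 : SiteZ d → Fin d → 𝔹ˣ) τ i ((L : ℤ) • z + offZ L r) ∈ unitaryUnits 𝔹 :=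
      fun r => (unitaryUnits 𝔹).mul_mem ((unitaryUnits 𝔹).inv_mem hU0) (ih hij.le _ (hzr r)).1
    -- the one-step formula `R̄₀^{i+1}τ(z) = R̄₀ⁱτ(L·z)·exp S`
    have hstep : uavgZ L (1 : SiteZ d → Fin d → 𝔹ˣ) τ (i + 1) z =
        uavgZ L (1 : SiteZ d → Fin d → 𝔹ˣ) τ i ((L : ℤ) • z) * expUnit (SexpZ L (uavgZ L (1 : SiteZ d → Fin d → 𝔹ˣ) τ i) ((L : ℤ) • z)) := by
      rw [uavgZ_succ, B7SectCDGaugeAveragesRec.R0avgZ, BlockAveragingZd.avgIterZ_one, B7Eq99Concrete.R0fun_one_left]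
      rfl
    -- the exponent is skew-adjoint and small
    have hS_skew : SexpZ L (uavgZ L (1 : SiteZ d → Fin d → 𝔹ˣ) τ i) ((L : ℤ) • z) ∈ skewAdjoint 𝔹 := by
      unfold B7SectCDGaugeAveragesRec.SexpZ
      refine sum_mem fun r _ => skewAdjoint.smul_mem _ ?_
      rw [skewAdjoint.mem_iff]
      exact star_mlog_eq_neg ((mem_unitaryUnits).1 (hrowU r)) ((hrow r).trans hP14)
    have hS_norm : ‖SexpZ L (uavgZ L (1 : SiteZ d → Fin d → 𝔹ˣ) τ i) ((L : ℤ) • z)‖ ≤ 2 * P := by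
      rw [B7Prop9FlatRec.SexpZ_eq_bmean]
      refine norm_bmean_le hL1 fun r => ?_
      exact (norm_mlog_le_two_mul ((hrow r).trans (hP14.trans (by norm_num)))).trans (by linarith [hrow r])
    have hexp : ‖NormedSpace.exp (SexpZ L (uavgZ L (1 : SiteZ d → Fin d → 𝔹ˣ) τ i) ((L : ℤ) • z)) - 1‖ ≤ 2 * P + (2 * P) ^ 2 :=
      norm_exp_sub_one_le_lin hS_norm hP1
    refine ⟨?_, ?_⟩
    · -- unitarity
      rw [hstep, mem_unitaryUnits, Units.val_mul, val_expUnit]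
      refine Submonoid.mul_mem _ ((mem_unitaryUnits).1 hU0) ?_
      letI : NormedAlgebra ℚ 𝔹 := NormedAlgebra.restrictScalars ℚ ℂ 𝔹
      exact NormedSpace.exp_mem_unitary_of_mem_skewAdjoint hS_skew
    · -- closeness to the centre value: `τ(c)⁻¹·R̄₀^{i+1}τ(z) = A₀·exp S`
      rw [hstep, ← mul_assoc, Units.val_mul, val_expUnit]
      refine (mul_sub_one_norm_le _ _).trans ?_
      have hP0 : 0 ≤ 2 * P + (2 * P) ^ 2 := by positivity
      calc (1 + ‖((((τ (((L : ℤ) ^ (i + 1)) • z))⁻¹ * uavgZ L (1 : SiteZ d → Fin d → 𝔹ˣ) τ i ((L : ℤ) • z) : 𝔹ˣ)) : 𝔹) - 1‖) *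
            (1 + ‖NormedSpace.exp (SexpZ L (uavgZ L (1 : SiteZ d → Fin d → 𝔹ˣ) τ i) ((L : ℤ) • z)) - 1‖) - 1
          ≤ (1 + 8 * θ * u) * (1 + (2 * P + (2 * P) ^ 2)) - 1 := by gcongr
        _ ≤ 8 * u := by rw [hPdef]; linarith [hD]
        _ = 8 * ω * θ ^ (j - (i + 1)) := by rw [hudef]; ring

/-! ## §3  The `p_i` rows and the `U1` rows of the localised cross-term bound, for `τ` -/

/-- ★★★ **THE IN-BLOCK OSCILLATION ROWS OF `R̄₀ⁱτ` UNDER THE CELL, FROM POINTWISE MULTISCALE OSCILLATION** — the `hp` rows of ✓p747787 `rbar_one_mul_sub_mul_le_tower_local` for the factor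
`τ` with `p_i := 4ω·θ^{j−(i+1)}` (geometric, top value `4ω`): for `i < j`, `z` under `y` at depth `j − (i+1)` and `x ∈ B(z)`, `‖(R̄₀ⁱτ(L·z))⁻¹·R̄₀ⁱτ(x) − 1‖ ≤ 4ω·θ^{j−(i+1)}`.
[cite: Balaban1985Averaging, (78)–(80) p.30, (167) p.44; Balaban1987RG1, (0.3)–(0.4) pp.252–253] -/
theorem osc_rows_of_pointwise_under {L : ℕ} (hL : Odd L) (τ : SiteZ d → 𝔹ˣ) (j : ℕ) (y : SiteZ d) {ω θ : ℝ}
    (hθ0 : 0 ≤ θ) (hθ : θ ≤ 1 / 8) (hω0 : 0 ≤ ω) (hω : ω ≤ 1 / 128)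
    (hτ : ∀ x, UnderZ L j y x → τ x ∈ unitaryUnits 𝔹)
    (hpt : ∀ i, i < j → ∀ z, UnderZ L (j - (i + 1)) y z → ∀ w, UnderZ L (i + 1) z w →
      ‖((((τ (((L : ℤ) ^ (i + 1)) • z))⁻¹ * τ w : 𝔹ˣ)) : 𝔹) - 1‖ ≤ ω * θ ^ (j - (i + 1))) :
    ∀ i, i < j → ∀ z, UnderZ L (j - (i + 1)) y z → ∀ x ∈ blockSitesZ L z,
      ‖(((uavgZ L (1 : SiteZ d → Fin d → 𝔹ˣ) τ i ((L : ℤ) • z))⁻¹ : 𝔹ˣ) : 𝔹) * ((uavgZ L (1 : SiteZ d → Fin d → 𝔹ˣ) τ i x : 𝔹ˣ) : 𝔹) - 1‖ ≤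
        4 * ω * θ ^ (j - (i + 1)) := by
  have main := uavgZ_one_unitary_and_near_centre_under hL τ j y hθ0 hθ hω0 hω hτ hpt
  intro i hij z hz x hx
  obtain ⟨r, rfl⟩ := mem_blockSitesZ.1 hx
  have hdepth : j - (i + 1) + 1 = j - i := by omega
  have hθpow : θ ^ (j - i) = θ * θ ^ (j - (i + 1)) := by rw [← hdepth, pow_succ, mul_comm]
  set u : ℝ := ω * θ ^ (j - (i + 1)) with hudef
  have hu0 : 0 ≤ u := by positivity
  have hu1 : u ≤ 1 / 128 := by
    calc u ≤ ω * 1 := by rw [hudef]; exact mul_le_mul_of_nonneg_left (pow_le_one₀ hθ0 (by linarith)) hω0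
      _ ≤ 1 / 128 := by linarith
  obtain ⟨hP4, -, -, -⟩ := step_arith hθ0 hθ hu0 hu1
  have hz0 : UnderZ L (j - i) y ((L : ℤ) • z) := by
    have h := underZ_add hL hz (underZ_one_centre L z); rwa [hdepth] at h
  have hzr : UnderZ L (j - i) y ((L : ℤ) • z + offZ L r) := by
    obtain ⟨s, hs⟩ := hL
    have h := underZ_add ⟨s, hs⟩ hz (underZ_one_block (by omega : L = 2 * s + 1) z r); rwa [hdepth] at h
  have hc : UnderZ L j y (((L : ℤ) ^ (i + 1)) • z) := by
    have h := underZ_add hL hz (underZ_pow_smul L (i + 1) z)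
    have e : j - (i + 1) + (i + 1) = j := by omega
    rwa [e] at h
  obtain ⟨hU0, hA0⟩ := main i hij.le _ hz0
  obtain ⟨hUr, hAr⟩ := main i hij.le _ hzr
  rw [pow_smul_Lsmul_eq_pow_succ_smul, hθpow] at hA0
  rw [hθpow] at hAr
  have hA0' : ‖((((τ (((L : ℤ) ^ (i + 1)) • z))⁻¹ * uavgZ L (1 : SiteZ d → Fin d → 𝔹ˣ) τ i ((L : ℤ) • z) : 𝔹ˣ)) : 𝔹) - 1‖ ≤ 8 * θ * u := by
    rw [hudef]; linarith
  have hAr' : ‖((((τ (((L : ℤ) ^ i) • ((L : ℤ) • z + offZ L r)))⁻¹ * uavgZ L (1 : SiteZ d → Fin d → 𝔹ˣ) τ i ((L : ℤ) • z + offZ L r) : 𝔹ˣ)) : 𝔹) - 1‖ ≤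
      8 * θ * u := by rw [hudef]; linarith
  have h := row_core (Cr := τ (((L : ℤ) ^ i) • ((L : ℤ) • z + offZ L r))) (hτ _ hc) hU0 hA0' hAr' (hpt i hij z hz _ (underZ_centre_of_block hL i z r)) rfl
  rw [← Units.val_mul]
  calc ‖((((uavgZ L (1 : SiteZ d → Fin d → 𝔹ˣ) τ i ((L : ℤ) • z))⁻¹ * uavgZ L (1 : SiteZ d → Fin d → 𝔹ˣ) τ i ((L : ℤ) • z + offZ L r) : 𝔹ˣ)) : 𝔹) - 1‖
      ≤ (1 + u) * (1 + 8 * θ * u) - 1 + 8 * θ * u := h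
    _ = u + 16 * θ * u + 8 * θ * u ^ 2 := by ring
    _ ≤ 4 * u := hP4
    _ = 4 * ω * θ ^ (j - (i + 1)) := by rw [hudef]; ring

/-- ★ **THE `U1` ROWS AT THE CENTRES UNDER THE CELL, FOR `τ`** (`‖R̄₀ⁱτ(L·z)‖ ≤ 1`, `‖R̄₀ⁱτ(L·z)⁻¹‖ ≤ 1`, from unitarity): the rows `ha1 ∕ ha1′` of ✓p747787 `rbar_one_mul_sub_mul_le_tower_local`.
[cite: Balaban1985Averaging, (78)–(80) p.30, (19) p.21; Balaban1987RG1, (0.4) p.253] -/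
theorem norm_uavgZ_one_le_one_of_pointwise_under {L : ℕ} (hL : Odd L) (τ : SiteZ d → 𝔹ˣ) (j : ℕ) (y : SiteZ d) {ω θ : ℝ}
    (hθ0 : 0 ≤ θ) (hθ : θ ≤ 1 / 8) (hω0 : 0 ≤ ω) (hω : ω ≤ 1 / 128)
    (hτ : ∀ x, UnderZ L j y x → τ x ∈ unitaryUnits 𝔹)
    (hpt : ∀ i, i < j → ∀ z, UnderZ L (j - (i + 1)) y z → ∀ w, UnderZ L (i + 1) z w →
      ‖((((τ (((L : ℤ) ^ (i + 1)) • z))⁻¹ * τ w : 𝔹ˣ)) : 𝔹) - 1‖ ≤ ω * θ ^ (j - (i + 1))) :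
    ∀ i, i < j → ∀ z, UnderZ L (j - (i + 1)) y z →
      ‖((uavgZ L (1 : SiteZ d → Fin d → 𝔹ˣ) τ i ((L : ℤ) • z) : 𝔹ˣ) : 𝔹)‖ ≤ 1 ∧
        ‖(((uavgZ L (1 : SiteZ d → Fin d → 𝔹ˣ) τ i ((L : ℤ) • z))⁻¹ : 𝔹ˣ) : 𝔹)‖ ≤ 1 := by
  intro i hij z hz
  have hdepth : j - (i + 1) + 1 = j - i := by omega
  have hz0 : UnderZ L (j - i) y ((L : ℤ) • z) := by
    have h := underZ_add hL hz (underZ_one_centre L z); rwa [hdepth] at h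
  have hU := (uavgZ_one_unitary_and_near_centre_under hL τ j y hθ0 hθ hω0 hω hτ hpt i hij.le _ hz0).1
  exact unitaryUnits_le_U1 hU

end Main

end Literature.MathematicalPhysics.QuantumFieldTheory.Balaban1983to89.B8ExpMeanLogOscFromPointwiseRec

end
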